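import Literature.NumberTheory.EllipticCurves.Kato2004.IwasawaH1ReductionPk
import Literature.NumberTheory.GaloisRepresentations.ContinuousShapiroLiftFunctor
import Literature.NumberTheory.EllipticCurves.KummerSequenceConnecting
import HarnessLib

/-!
# Kato (2004), §13.8 / Perrin-Riou (1987), §0 — the reductions `red_{p^k} : H¹(U, T_pW) → H¹(U, W[p^k])`
# ALONG SEVERAL LEVELS, typing-agnostic: `[p^j]_* red_{p^{k+j}} = red_{p^k}` through ANY level maps

`Proofs`-style companion of `Kato2004/IwasawaH1ReductionPk.lean` (theorems only: no definition, no named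
fact, no instance, no `sorry`).  The tree's `mapH1AddHom_reduceH1Pk_succ` is the one-step tower
compatibility `[p]_* red_{p^{k+1}} = red_{p^k}` for a transition map `W[p^{k+1}] → W[p^k]` typed at the
integer-power levels `(p : ℤ) ^ k` of `reduceH1Pk`.  Consumers pairing the reduced classes with the WEIL
PAIRING must re-type the coefficients at natural-number levels `((p^k : ℕ) : ℤ)` (the tree's
`weilContPairing W n`, `DiscreteGaloisModule.mu F n`, `n : ℕ`), and compare two levels `k ≤ k + j` at
once.  This file proves the `j`-step compatibility THROUGH ARBITRARY LEVEL MAPS GIVEN ON POINTS, so that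
any re-typing is absorbed in the maps:

* `zsmulMap_subgroupRep` / `coeMap_subgroupRep` — an additive map `f : W[m₁] → W[m₂]` between torsion
  levels acting on points as `P ↦ c • P` (resp. `P ↦ P`) is `U`-equivariant (generalises
  `transition_subgroupRep`);
* `pow_zsmul_coe_tateModPk_add` — `p^j • (a mod p^{k+j}) = a mod p^k` in `E(ℚ̄)` (iterate of
  `zsmul_coe_tateModPk_succ`);
* **`mapH1AddHom_reduceH1Pk_add`** — for `f₁ : W[p^{k+j}] → W[m]`, `P ↦ p^j • P` on points, and
  `f₂ : W[p^k] → W[m]`, `P ↦ P` on points (ANY integer level `m`):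
  `(f₁)_* (red_{p^{k+j}} c) = (f₂)_* (red_{p^k} c)` in `H¹(U, W[m])`;
* **`cohomologyMap_mapH1AddHom_reduceH1Pk_add`** — the same with the multiplication split off as a
  morphism of discrete Galois modules `α : W[m₁] → W[m₂]` (`S ↦ p^j • S` on points) applied through
  Mathlib's `cohomologyMap (subgroupRepMap (homOfIntertwining α) U) 1`, after re-typings
  `r₁ : W[p^{k+j}] → W[m₁]`, `r₂ : W[p^k] → W[m₂]` (identity on points):
  `α_* ((r₁)_* red_{p^{k+j}} c) = (r₂)_* red_{p^k} c` — the shape `a_K = α_* a_{K'}` of the level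
  transport of Shapiro cup classes (`WeilPairingShapiroLevelTransport.lean`).

Consumer: crux K3 of `Summits/BirchSwinnertonDyer` ((PT-orth), step [S2-B3]: the `a`-side of
`c_{K'} = (ι_μ)_* c_K` with `a_K = red_{2^K}(proj_N x)`).

## References
* [Kato2004Asterisque] K. Kato, *p-adic Hodge theory and values of zeta functions of modular forms*,
  Astérisque 295 (2004), §13.8 (p. 228).
* [PerrinRiou1987BSMF] B. Perrin-Riou, *Fonctions L p-adiques, théorie d'Iwasawa et points de Heegner*,
  Bull. SMF 115 (1987), §0 (p. 401).
* [SerreGaloisCohomology1997] J.-P. Serre, *Galois Cohomology* (1997), I §2.2.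
-/

noncomputable section

open scoped NumberField
open Field IsDedekindDomain CategoryTheory
open Literature.NumberTheory.GaloisRepresentations
open Literature.NumberTheory.EllipticCurves Literature.NumberTheory.EllipticCurves.Kato2004
open Literature.NumberTheory.EllipticCurves.Kato2004.EulerSystemValues
open WeierstrassCurve (geomPoints geomTorsion)
open _root_.TopRep _root_.ContinuousCohomology
open scoped ContRepresentation

universe u

/-! ## §1 Level maps given on points are equivariant -/

namespace Literature.NumberTheory.EllipticCurves

section LevelMaps

variable {K : Type u} [Field K] (W : WeierstrassCurve K) {m₁ m₂ : ℤ}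

/-- An additive map `f : W[m₁] → W[m₂]` between torsion levels acting on points as `P ↦ c • P` is
`U`-equivariant for the restricted torsion Galois modules, for every subgroup `U ≤ Γ_K` (the Galois action
commutes with multiplication by `c`; Perrin-Riou's transition maps are maps of Galois modules).
[cite: PerrinRiou1987BSMF, §0 (p. 401)] -/
theorem zsmulMap_subgroupRep (c : ℤ) (f : geomTorsion W m₁ →+ geomTorsion W m₂)
    (hf : ∀ P, ((f P : geomTorsion W m₂) : geomPoints W) = c • (P : geomPoints W))
    (U : Subgroup (absoluteGaloisGroup K)) (u : U) (P : geomTorsion W m₁) :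
    f ((subgroupRep (W.torsionGaloisModule m₁).toTopRep U).ρ u P) =
      (subgroupRep (W.torsionGaloisModule m₂).toTopRep U).ρ u (f P) := by
  apply Subtype.ext
  change ((f ((u : absoluteGaloisGroup K) • P) : geomTorsion W m₂) : geomPoints W) =
    (((u : absoluteGaloisGroup K) • f P : geomTorsion W m₂) : geomPoints W)
  rw [hf, AddSubgroup.torsionBy.coe_smul, AddSubgroup.torsionBy.coe_smul, hf]
  exact (map_zsmul (DistribSMul.toAddMonoidHom (geomPoints W) (u : absoluteGaloisGroup K)) c
    (P : geomPoints W)).symm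

/-- An additive map `f : W[m₁] → W[m₂]` between torsion levels which is the identity on points
(an inclusion of levels, or a re-typing `W[(p:ℤ)^k] → W[((p^k : ℕ) : ℤ)]`) is `U`-equivariant.
[cite: PerrinRiou1987BSMF, §0 (p. 401)] -/
theorem coeMap_subgroupRep (f : geomTorsion W m₁ →+ geomTorsion W m₂)
    (hf : ∀ P, ((f P : geomTorsion W m₂) : geomPoints W) = (P : geomPoints W))
    (U : Subgroup (absoluteGaloisGroup K)) (u : U) (P : geomTorsion W m₁) :
    f ((subgroupRep (W.torsionGaloisModule m₁).toTopRep U).ρ u P) =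
      (subgroupRep (W.torsionGaloisModule m₂).toTopRep U).ρ u (f P) :=
  zsmulMap_subgroupRep W 1 f (fun P ↦ by rw [hf, one_zsmul]) U u P

end LevelMaps

end Literature.NumberTheory.EllipticCurves

/-! ## §2 `red_{p^k}` across `j` levels -/

namespace Literature.NumberTheory.EllipticCurves.Kato2004

section Transition

variable (W : WeierstrassCurve ℚ) [W.IsElliptic] (p : ℕ) [Fact p.Prime] (k : ℕ)

omit [W.IsElliptic] [Fact p.Prime] in
/-- **`p^j • (a mod p^{k+j}) = a mod p^k`** in `E(ℚ̄)` for `a ∈ T_pW` (iterate of the transition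
relation `p • a_{k+1} = a_k`, `zsmul_coe_tateModPk_succ`). [cite: Kato2004Asterisque, §13.8 (p. 228)] -/
theorem pow_zsmul_coe_tateModPk_add (j : ℕ) (a : W.tateModule p) :
    (p : ℤ) ^ j • ((tateModPk W p (k + j) a : geomTorsion W ((p : ℤ) ^ (k + j))) : geomPoints W) =
      ((tateModPk W p k a : geomTorsion W ((p : ℤ) ^ k)) : geomPoints W) := by
  induction j with
  | zero => rw [pow_zero, one_smul]; rfl
  | succ j ih =>
    rw [pow_succ, mul_smul]
    show (p : ℤ) ^ j • ((p : ℤ) • ((tateModPk W p (k + j + 1) a : geomTorsion W ((p : ℤ) ^ (k + j + 1))) :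
      geomPoints W)) = _
    rw [zsmul_coe_tateModPk_succ, ih]

variable [ContinuousSMul ℤ_[p] (W.tateModule p)]

/-- **The reductions across `j` levels, through arbitrary level maps given on points**: for an additive
continuous equivariant `f₁ : W[p^{k+j}] → W[m]` acting on points as `P ↦ p^j • P` and
`f₂ : W[p^k] → W[m]` acting as `P ↦ P` (ANY integer level `m`, e.g. `((p^k : ℕ) : ℤ)`),
`(f₁)_* (red_{p^{k+j}} c) = (f₂)_* (red_{p^k} c)` in `H¹(U, W[m])` for every `c ∈ H¹(U, T_pW)` — on
cocycles, `p^j • (a mod p^{k+j}) = a mod p^k` componentwise.  (`j = 1`, `m = p^k`, `f₂ = id`: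
the tree's `mapH1AddHom_reduceH1Pk_succ`.) [cite: Kato2004Asterisque, §13.8 (p. 228)]
[cite: PerrinRiou1987BSMF, §0 (p. 401)] -/
theorem mapH1AddHom_reduceH1Pk_add (U : Subgroup (absoluteGaloisGroup ℚ)) (j : ℕ) {m : ℤ}
    (f₁ : geomTorsion W ((p : ℤ) ^ (k + j)) →+ geomTorsion W m) (hf₁c : Continuous f₁)
    (hρ₁ : ∀ (u : U) (P : geomTorsion W ((p : ℤ) ^ (k + j))),
      f₁ ((subgroupRep (W.torsionGaloisModule ((p : ℤ) ^ (k + j))).toTopRep U).ρ u P) =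
        (subgroupRep (W.torsionGaloisModule m).toTopRep U).ρ u (f₁ P))
    (hf₁ : ∀ P, ((f₁ P : geomTorsion W m) : geomPoints W) = (p : ℤ) ^ j • (P : geomPoints W))
    (f₂ : geomTorsion W ((p : ℤ) ^ k) →+ geomTorsion W m) (hf₂c : Continuous f₂)
    (hρ₂ : ∀ (u : U) (P : geomTorsion W ((p : ℤ) ^ k)),
      f₂ ((subgroupRep (W.torsionGaloisModule ((p : ℤ) ^ k)).toTopRep U).ρ u P) =
        (subgroupRep (W.torsionGaloisModule m).toTopRep U).ρ u (f₂ P))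
    (hf₂ : ∀ P, ((f₂ P : geomTorsion W m) : geomPoints W) = (P : geomPoints W))
    (c : H1 (tateRep W p) U) :
    mapH1AddHom (subgroupRep (W.torsionGaloisModule ((p : ℤ) ^ (k + j))).toTopRep U)
        (subgroupRep (W.torsionGaloisModule m).toTopRep U) f₁ hf₁c hρ₁ (reduceH1Pk W p (k + j) U c) =
      mapH1AddHom (subgroupRep (W.torsionGaloisModule ((p : ℤ) ^ k)).toTopRep U)
        (subgroupRep (W.torsionGaloisModule m).toTopRep U) f₂ hf₂c hρ₂ (reduceH1Pk W p k U c) := by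
  obtain ⟨φ, rfl⟩ := oneCocycleClass_surjective _ c
  rw [reduceH1Pk_oneCocycleClass, reduceH1Pk_oneCocycleClass, mapH1AddHom_oneCocycleClass,
    mapH1AddHom_oneCocycleClass]
  refine congrArg _ (Subtype.ext (ContinuousMap.ext fun g ↦ Subtype.ext ?_))
  change ((f₁ (tateModPk W p (k + j) (φ.1 g)) : geomTorsion W m) : geomPoints W) =
    ((f₂ (tateModPk W p k (φ.1 g)) : geomTorsion W m) : geomPoints W)
  rw [hf₁, hf₂, pow_zsmul_coe_tateModPk_add]

/-- **`a_K = α_* a_{K'}` for the re-typed reductions.**  Let `r₁ : W[p^{k+j}] → W[m₁]` and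
`r₂ : W[p^k] → W[m₂]` be additive continuous equivariant maps which are the identity on points
(re-typings of the levels, e.g. `m₁ = p^{k+j}`, `m₂ = p^k` read in `ℕ`), and `α : W[m₁] → W[m₂]` a
morphism of discrete Galois modules acting on points as `S ↦ p^j • S`.  Then for every
`c ∈ H¹(U, T_pW)`:  `α_* ((r₁)_* red_{p^{k+j}} c) = (r₂)_* red_{p^k} c` in `H¹(U, W[m₂])`, with `α_*`
Mathlib's `cohomologyMap` of `subgroupRepMap (homOfIntertwining α) U` (the currency of the Shapiro-lift
files). [cite: Kato2004Asterisque, §13.8 (p. 228)] [cite: PerrinRiou1987BSMF, §0 (p. 401)] -/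
theorem cohomologyMap_mapH1AddHom_reduceH1Pk_add (U : Subgroup (absoluteGaloisGroup ℚ)) (j : ℕ)
    {m₁ m₂ : ℤ}
    (r₁ : geomTorsion W ((p : ℤ) ^ (k + j)) →+ geomTorsion W m₁) (hr₁c : Continuous r₁)
    (hρ₁ : ∀ (u : U) (P : geomTorsion W ((p : ℤ) ^ (k + j))),
      r₁ ((subgroupRep (W.torsionGaloisModule ((p : ℤ) ^ (k + j))).toTopRep U).ρ u P) =
        (subgroupRep (W.torsionGaloisModule m₁).toTopRep U).ρ u (r₁ P))
    (hr₁ : ∀ P, ((r₁ P : geomTorsion W m₁) : geomPoints W) = (P : geomPoints W))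
    (r₂ : geomTorsion W ((p : ℤ) ^ k) →+ geomTorsion W m₂) (hr₂c : Continuous r₂)
    (hρ₂ : ∀ (u : U) (P : geomTorsion W ((p : ℤ) ^ k)),
      r₂ ((subgroupRep (W.torsionGaloisModule ((p : ℤ) ^ k)).toTopRep U).ρ u P) =
        (subgroupRep (W.torsionGaloisModule m₂).toTopRep U).ρ u (r₂ P))
    (hr₂ : ∀ P, ((r₂ P : geomTorsion W m₂) : geomPoints W) = (P : geomPoints W))
    (α : (W.torsionGaloisModule m₁).toContRepresentation →ⁱL (W.torsionGaloisModule m₂).toContRepresentation)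
    (hα : ∀ S : geomTorsion W m₁, ((α S : geomTorsion W m₂) : geomPoints W) = (p : ℤ) ^ j • (S : geomPoints W))
    (c : H1 (tateRep W p) U) :
    cohomologyMap (subgroupRepMap (DiscreteGaloisModule.homOfIntertwining α) U) 1
        (mapH1AddHom (subgroupRep (W.torsionGaloisModule ((p : ℤ) ^ (k + j))).toTopRep U)
          (subgroupRep (W.torsionGaloisModule m₁).toTopRep U) r₁ hr₁c hρ₁ (reduceH1Pk W p (k + j) U c)) =
      mapH1AddHom (subgroupRep (W.torsionGaloisModule ((p : ℤ) ^ k)).toTopRep U)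
        (subgroupRep (W.torsionGaloisModule m₂).toTopRep U) r₂ hr₂c hρ₂ (reduceH1Pk W p k U c) := by
  obtain ⟨φ, rfl⟩ := oneCocycleClass_surjective _ c
  rw [reduceH1Pk_oneCocycleClass, reduceH1Pk_oneCocycleClass, mapH1AddHom_oneCocycleClass,
    mapH1AddHom_oneCocycleClass, cohomologyMap_oneCocycleClass]
  refine congrArg _ (Subtype.ext (ContinuousMap.ext fun g ↦ Subtype.ext ?_))
  change ((α (r₁ (tateModPk W p (k + j) (φ.1 g))) : geomTorsion W m₂) : geomPoints W) =
    ((r₂ (tateModPk W p k (φ.1 g)) : geomTorsion W m₂) : geomPoints W)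
  rw [hα, hr₁, hr₂, pow_zsmul_coe_tateModPk_add]

end Transition

end Literature.NumberTheory.EllipticCurves.Kato2004
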